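import Summits.Parity.BatemanHorn.Theorems.NormalFamilyBound.Negative.RealAxis
import Literature.NumberTheory.LFunctions.SelbergDelangeOmega

/-!
# `NormalFamilyBound` — calibration at `f = (X)`: the printed Selberg–Delange law gives the crux for the integers

Support for crux `stmt-Parity-9769` (`Summit.Parity.BatemanHorn.Theses.SelbergDelangeRigidity.NormalFamilyBound`),
vocabulary of `Negative/RealAxis.lean`. The grounder's "item = fact ∘ specialisation" for `k = 1`, `f = X`, CHECKED:

* `fX_mem_locallyBoundedSystems_of_MV` — the vendored fact
  `Literature.NumberTheory.LFunctions.MontgomeryVaughan2007_thm_7_18_Omega` (Montgomery–Vaughan, Multiplicative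
  Number Theory I, Thm 7.18 with (7.60): `Σ_{n≤x} z^{Ω(n)} = F(1,z)/Γ(z)·x(log x)^{z−1} + O(x(log x)^{Re z−2})`
  uniformly on `|z| ≤ R < 2`) implies `(X) ∈ locallyBoundedSystems (7/4) 1`, i.e. the `k = 1`, `f = X` instance of
  the crux with EXACTLY the crux's normalisation `x⁻¹(log x)^{1−z}`, its junk terms (`n = 0`; `x ≤ 2`, where
  `log log x ∈ {0, log log 2}`) and its rectangle (`V_{7/4,1/4} ⊂ {|z| ≤ 9/5}`, `R = 9/5 < 2`). A mis-normalised
  or junk-leaking crux would have been refuted by this computation; it is not.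
* `norm_G_le` — the one trick: the printed theorem at `x = 2` (`A_z(2) = 1 + z`) bounds the main-term coefficient
  `G(z) = F(1,z)/Γ(z)` uniformly on `|z| ≤ 9/5`, so no continuity of the Euler product `F(1,·)` is needed.

So for the integers the crux is precisely the printed theorem; for `deg f ≥ 2` or `k ≥ 2` nothing of the kind is in
print (grounding notes on the item). Standing disprover's work file:
`Summits/Parity/BatemanHorn/Cruxes/NormalFamilyBound/Disproof.lean`.
-/

namespace Summit.Parity.BatemanHorn.Theorems.NormalFamilyBound.Negative

open Literature.NumberTheory.Sieve Polynomial Finset Filter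
open Summit.Parity.BatemanHorn.Theses.SelbergDelangeRigidity
open Literature.NumberTheory.LFunctions (selbergDelangeOmegaF MontgomeryVaughan2007_thm_7_18_Omega)

noncomputable section

/-- The sum of the crux for `f = (X)` is `1 + A_z(x)`, `A_z(x) = Σ_{1 ≤ n ≤ x} z^{Ω(n)}` (the `n = 0` term
is `z^{Ω(0)} = z^0 = 1`). [folklore] -/
theorem sum_fX_eq (x : ℕ) (z : ℂ) :
    ∑ n ∈ range (x + 1), z ^ (∑ i, ArithmeticFunction.cardFactors (((fX i).eval (n : ℤ)).toNat)) =
      1 + ∑ n ∈ Finset.Icc 1 x, z ^ ArithmeticFunction.cardFactors n := by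
  have h : ∀ n : ℕ, (∑ i, ArithmeticFunction.cardFactors (((fX i).eval (n : ℤ)).toNat)) =
      ArithmeticFunction.cardFactors n := fun n => by simp [fX]
  simp_rw [h]
  rw [Nat.range_succ_eq_Icc_zero, Finset.Icc_eq_cons_Ioc (Nat.zero_le x), Finset.sum_cons,
    ← Finset.Icc_add_one_left_eq_Ioc, zero_add]
  simp

/-- `A_z(2) = 1 + z`. [folklore] -/
theorem sum_Icc_one_two (z : ℂ) : ∑ n ∈ Finset.Icc 1 2, z ^ ArithmeticFunction.cardFactors n = 1 + z := by
  rw [show Finset.Icc 1 2 = {1, 2} from rfl, Finset.sum_pair (by norm_num)]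
  simp [ArithmeticFunction.cardFactors_apply_prime Nat.prime_two]

/-- The thin rectangle `V_{7/4,1/4}` lies in the closed disc of radius `9/5` (and has `−1/4 < Re z < 7/4`).
[folklore] -/
theorem norm_le_of_mem_V {z : ℂ} (hz : z ∈ V (7 / 4) (1 / 4)) : ‖z‖ ≤ 9 / 5 := by
  obtain ⟨h1, h2, h3⟩ := hz
  have him := abs_lt.mp h3
  have hsq : ‖z‖ ^ 2 ≤ (9 / 5) ^ 2 := by
    rw [Complex.sq_norm, Complex.normSq_apply]
    nlinarith [him.1, him.2]
  exact le_of_pow_le_pow_left₀ (by norm_num) (by norm_num) hsq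

/-- STEP 1. The printed theorem at `x = 2` bounds the main-term coefficient `G(z) = F(1,z)/Γ(z)` uniformly:
`‖G(z)‖ ≤ (3/2)(log 2)^{−4/5} + |C| (log 2)^{−1}` for `‖z‖ ≤ 9/5` (no continuity of `F(1,·)` needed).
[cite: MontgomeryVaughan2007, §7.4 Theorem 7.18] -/
theorem norm_G_le {C : ℝ}
    (hC : ∀ x : ℝ, 2 ≤ x → ∀ z : ℂ, ‖z‖ ≤ 9 / 5 →
      ‖(∑ n ∈ Finset.Icc 1 ⌊x⌋₊, z ^ (ArithmeticFunction.cardFactors n)) -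
          selbergDelangeOmegaF z * (Complex.Gamma z)⁻¹ * (x : ℂ) * ((Real.log x : ℝ) : ℂ) ^ (z - 1)‖ ≤
        C * x * Real.log x ^ (z.re - 2))
    {z : ℂ} (hz : ‖z‖ ≤ 9 / 5) :
    ‖selbergDelangeOmegaF z * (Complex.Gamma z)⁻¹‖ ≤
      3 / 2 * Real.log 2 ^ (-(4 / 5) : ℝ) + |C| * (Real.log 2)⁻¹ := by
  set G : ℂ := selbergDelangeOmegaF z * (Complex.Gamma z)⁻¹ with hG
  set l : ℝ := Real.log 2 with hl
  have hl0 : 0 < l := Real.log_pos one_lt_two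
  have hl1 : l ≤ 1 := by
    have := Real.log_le_sub_one_of_pos (by norm_num : (0 : ℝ) < 2); rw [hl]; linarith
  have h2 := hC 2 le_rfl z hz
  have hfloor : ⌊(2 : ℝ)⌋₊ = 2 := by norm_num
  rw [hfloor, sum_Icc_one_two] at h2
  -- ‖G * 2 * l^(z-1)‖ = ‖G‖ * 2 * l^(Re z - 1)
  have hmain : ‖G * (2 : ℝ) * ((l : ℝ) : ℂ) ^ (z - 1)‖ = ‖G‖ * 2 * l ^ (z.re - 1) := by
    rw [norm_mul, norm_mul, Complex.norm_cpow_eq_rpow_re_of_pos hl0]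
    simp
  have htri : ‖G‖ * 2 * l ^ (z.re - 1) ≤ ‖(1 : ℂ) + z‖ + C * 2 * l ^ (z.re - 2) := by
    rw [← hmain]
    have := norm_sub_norm_le (G * (2 : ℝ) * ((l : ℝ) : ℂ) ^ (z - 1)) (1 + z)
    rw [norm_sub_rev] at this
    push_cast at h2 this ⊢
    linarith
  have h1z : ‖(1 : ℂ) + z‖ ≤ 3 := by
    calc ‖(1 : ℂ) + z‖ ≤ ‖(1 : ℂ)‖ + ‖z‖ := norm_add_le _ _
      _ ≤ 1 + 9 / 5 := by rw [norm_one]; gcongr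
      _ ≤ 3 := by norm_num
  -- multiply through by l^(1 - Re z) / 2
  have hpow1 : l ^ (z.re - 1) * l ^ (1 - z.re) = 1 := by
    rw [← Real.rpow_add hl0]; simp
  have hpow2 : l ^ (z.re - 2) * l ^ (1 - z.re) = l⁻¹ := by
    rw [← Real.rpow_add hl0, show z.re - 2 + (1 - z.re) = (-1 : ℝ) by ring, Real.rpow_neg_one]
  have hre : z.re ≤ 9 / 5 := (Complex.re_le_norm z).trans hz
  have hexp : l ^ (1 - z.re) ≤ l ^ (-(4 / 5) : ℝ) :=
    Real.rpow_le_rpow_of_exponent_ge hl0 hl1 (by linarith)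
  have hq : 0 < l ^ (1 - z.re) := Real.rpow_pos_of_pos hl0 _
  have key : ‖G‖ * 2 ≤ 3 * l ^ (-(4 / 5) : ℝ) + |C| * 2 * l⁻¹ := by
    have := mul_le_mul_of_nonneg_right htri hq.le
    rw [show ‖G‖ * 2 * l ^ (z.re - 1) * l ^ (1 - z.re) = ‖G‖ * 2 * (l ^ (z.re - 1) * l ^ (1 - z.re)) by ring,
      hpow1, mul_one, add_mul,
      show C * 2 * l ^ (z.re - 2) * l ^ (1 - z.re) = C * 2 * (l ^ (z.re - 2) * l ^ (1 - z.re)) by ring,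
      hpow2] at this
    have hC' : C * 2 * l⁻¹ ≤ |C| * 2 * l⁻¹ := by
      have := le_abs_self C
      have : 0 ≤ l⁻¹ := inv_nonneg.mpr hl0.le
      gcongr
    have h3 : ‖(1 : ℂ) + z‖ * l ^ (1 - z.re) ≤ 3 * l ^ (-(4 / 5) : ℝ) := by gcongr
    linarith
  linarith

/-- STEP 2 (small `x`). For `x ≤ 2` and `−1/4 < Re z < 7/4`, `‖z‖ ≤ 9/5`: `‖H_x(z)‖ ≤ 48` (three terms,
`Ω ≤ 1`, `|log log x| ≤ 1` in the junk/real cases `x = 0, 1, 2`). [folklore] -/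
theorem norm_H_fX_le_of_le_two {x : ℕ} (hx : x ≤ 2) {z : ℂ} (hz : ‖z‖ ≤ 9 / 5) (hre1 : -1 < z.re)
    (hre2 : z.re < 7 / 4) : ‖H 1 fX x z‖ ≤ 48 := by
  have hLabs : |Real.log (Real.log (x : ℝ))| ≤ 1 := by
    interval_cases x
    · simp
    · simp
    · rw [show ((2 : ℕ) : ℝ) = 2 by norm_num]
      have hl0 : (1 : ℝ) / 2 < Real.log 2 := by have := Real.log_two_gt_d9; linarith
      have hl1 : Real.log 2 ≤ 1 := by
        have := Real.log_le_sub_one_of_pos (by norm_num : (0 : ℝ) < 2); linarith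
      have hup : Real.log (Real.log 2) ≤ 0 := Real.log_nonpos (by linarith) hl1
      have hdown : -1 ≤ Real.log (Real.log 2) := by
        have h := Real.log_le_log (by norm_num : (0:ℝ) < 1 / 2) hl0.le
        have e : Real.log (1 / 2 : ℝ) = -Real.log 2 := by rw [one_div, Real.log_inv]
        rw [e] at h
        linarith
      exact abs_le.mpr ⟨hdown, by linarith⟩
  -- the normaliser
  have hN : ‖Complex.exp (((1 : ℕ) : ℂ) * (1 - z) * (Real.log (Real.log (x : ℝ)) : ℂ))‖ ≤ 8 := by
    rw [Complex.norm_exp]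
    have hre : (((1 : ℕ) : ℂ) * (1 - z) * (Real.log (Real.log (x : ℝ)) : ℂ)).re =
        (1 - z.re) * Real.log (Real.log (x : ℝ)) := by
      simp [Complex.mul_re]
    rw [hre]
    have h1 : |1 - z.re| ≤ 2 := by rw [abs_le]; constructor <;> linarith
    have h2 : (1 - z.re) * Real.log (Real.log (x : ℝ)) ≤ 2 := by
      calc (1 - z.re) * Real.log (Real.log (x : ℝ)) ≤ |(1 - z.re) * Real.log (Real.log (x : ℝ))| :=
            le_abs_self _
        _ = |1 - z.re| * |Real.log (Real.log (x : ℝ))| := abs_mul _ _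
        _ ≤ 2 * 1 := by gcongr
        _ = 2 := by norm_num
    have he2 : Real.exp 2 ≤ 8 := by
      have h := Real.exp_one_lt_d9
      have e : Real.exp 2 = Real.exp 1 * Real.exp 1 := by rw [← Real.exp_add]; norm_num
      rw [e]; nlinarith [Real.exp_pos 1]
    exact (Real.exp_le_exp.mpr h2).trans he2
  -- the sum: x + 1 ≤ 3 terms each of norm ≤ 2
  have hS : ‖∑ n ∈ range (x + 1), z ^ (∑ i, ArithmeticFunction.cardFactors (((fX i).eval (n : ℤ)).toNat))‖
      ≤ 6 := by
    have hterm : ∀ n ∈ range (x + 1),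
        ‖z ^ (∑ i, ArithmeticFunction.cardFactors (((fX i).eval (n : ℤ)).toNat))‖ ≤ 2 := by
      intro n hn
      have hn2 : n ≤ 2 := by have := mem_range.mp hn; omega
      have hΩ : (∑ i, ArithmeticFunction.cardFactors (((fX i).eval (n : ℤ)).toNat)) ≤ 1 := by
        simp only [fX, Fin.sum_univ_one, Matrix.cons_val_fin_one, eval_X, Int.toNat_natCast]
        interval_cases n <;> simp [ArithmeticFunction.cardFactors_apply_prime Nat.prime_two]
      rw [norm_pow]
      rcases Nat.le_one_iff_eq_zero_or_eq_one.mp hΩ with h | h <;> rw [h]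
      · simp
      · rw [pow_one]; linarith
    calc _ ≤ ∑ n ∈ range (x + 1), ‖z ^ (∑ i, ArithmeticFunction.cardFactors (((fX i).eval (n : ℤ)).toNat))‖ :=
          norm_sum_le _ _
      _ ≤ ∑ n ∈ range (x + 1), (2 : ℝ) := sum_le_sum hterm
      _ = 2 * (x + 1) := by simp; ring
      _ ≤ 6 := by
          have : (x : ℝ) ≤ 2 := by exact_mod_cast hx
          linarith
  have hxinv : ‖((x : ℕ) : ℂ)⁻¹‖ ≤ 1 := by
    rw [norm_inv, Complex.norm_natCast]
    rcases Nat.eq_zero_or_pos x with rfl | hx0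
    · simp
    · exact inv_le_one_of_one_le₀ (by exact_mod_cast hx0)
  simp only [H]
  rw [norm_mul, norm_mul]
  calc _ ≤ 1 * 8 * 6 :=
        mul_le_mul (mul_le_mul hxinv hN (norm_nonneg _) zero_le_one) hS (norm_nonneg _) (by norm_num)
    _ = 48 := by norm_num

/-- `x⁻¹ (log x)^t ≤ 4` for `x ≥ 3`, `t ≤ 2` (as `log x ≤ 2 √x` and `log x ≥ 1`). [folklore] -/
theorem inv_mul_log_rpow_le {x : ℕ} (hx : 3 ≤ x) {t : ℝ} (ht : t ≤ 2) :
    (x : ℝ)⁻¹ * Real.log x ^ t ≤ 4 := by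
  have hx0 : (0 : ℝ) < x := by exact_mod_cast (by omega : 0 < x)
  have hx3 : (3 : ℝ) ≤ x := by exact_mod_cast hx
  have hlog3 : (1 : ℝ) < Real.log 3 := by
    rw [Real.lt_log_iff_exp_lt (by norm_num)]
    have := Real.exp_one_lt_d9; linarith
  have hl1 : 1 ≤ Real.log x := hlog3.le.trans (Real.log_le_log (by norm_num) hx3)
  have h1 : Real.log x ^ t ≤ Real.log x ^ (2 : ℝ) := Real.rpow_le_rpow_of_exponent_le hl1 ht
  have h2 : Real.log x ≤ 2 * (x : ℝ) ^ (1 / 2 : ℝ) := by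
    have := Real.log_le_rpow_div hx0.le (by norm_num : (0 : ℝ) < 1 / 2)
    linarith
  have h3 : Real.log x ^ (2 : ℝ) ≤ 4 * x := by
    rw [Real.rpow_two]
    have hs : ((x : ℝ) ^ (1 / 2 : ℝ)) ^ 2 = x := by
      rw [← Real.rpow_natCast, ← Real.rpow_mul hx0.le]; norm_num
    have h0 : 0 ≤ Real.log x := by linarith
    nlinarith [hs, h2, h0]
  rw [inv_mul_le_iff₀ hx0]
  linarith

/-- STEP 3 (large `x`). For `x ≥ 3`, `z ∈ V_{7/4,1/4}`: `‖H_x(z)‖ ≤ 4 + |C| + K` where `K` bounds `‖G‖`.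
[cite: MontgomeryVaughan2007, §7.4 Theorem 7.18] -/
theorem norm_H_fX_le_of_three_le {C K : ℝ}
    (hC : ∀ x : ℝ, 2 ≤ x → ∀ z : ℂ, ‖z‖ ≤ 9 / 5 →
      ‖(∑ n ∈ Finset.Icc 1 ⌊x⌋₊, z ^ (ArithmeticFunction.cardFactors n)) -
          selbergDelangeOmegaF z * (Complex.Gamma z)⁻¹ * (x : ℂ) * ((Real.log x : ℝ) : ℂ) ^ (z - 1)‖ ≤
        C * x * Real.log x ^ (z.re - 2))
    (hK : ∀ z : ℂ, ‖z‖ ≤ 9 / 5 → ‖selbergDelangeOmegaF z * (Complex.Gamma z)⁻¹‖ ≤ K)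
    {x : ℕ} (hx : 3 ≤ x) {z : ℂ} (hzV : z ∈ V (7 / 4) (1 / 4)) :
    ‖H 1 fX x z‖ ≤ 4 + |C| + K := by
  have hz : ‖z‖ ≤ 9 / 5 := norm_le_of_mem_V hzV
  obtain ⟨hre1, hre2, -⟩ := hzV
  have hx0 : (0 : ℝ) < x := by exact_mod_cast (by omega : 0 < x)
  have hx3 : (3 : ℝ) ≤ x := by exact_mod_cast hx
  -- the printed theorem at x (BEFORE naming the pieces, so that `set` abstracts inside it)
  have h2 := hC x (by linarith) z hz
  rw [Nat.floor_natCast] at h2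
  set G : ℂ := selbergDelangeOmegaF z * (Complex.Gamma z)⁻¹ with hG
  set l : ℝ := Real.log (x : ℝ) with hl
  set L : ℝ := Real.log l with hL
  have hlog3 : (1 : ℝ) < Real.log 3 := by
    rw [Real.lt_log_iff_exp_lt (by norm_num)]
    have := Real.exp_one_lt_d9; linarith
  have hl1 : 1 ≤ l := hlog3.le.trans (Real.log_le_log (by norm_num) hx3)
  have hl0 : 0 < l := by linarith
  have hK0 : 0 ≤ K := (norm_nonneg _).trans (hK z hz)
  set A : ℂ := ∑ n ∈ Finset.Icc 1 x, z ^ ArithmeticFunction.cardFactors n with hA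
  -- norms of the pieces
  have hN : ‖Complex.exp (((1 : ℕ) : ℂ) * (1 - z) * (L : ℂ))‖ = l ^ (1 - z.re) := by
    rw [Complex.norm_exp]
    have hre : (((1 : ℕ) : ℂ) * (1 - z) * (L : ℂ)).re = (1 - z.re) * L := by
      simp [Complex.mul_re]
    rw [hre, Real.rpow_def_of_pos hl0, mul_comm]
  have hmainnorm : ‖G * (x : ℝ) * ((l : ℝ) : ℂ) ^ (z - 1)‖ = ‖G‖ * x * l ^ (z.re - 1) := by
    rw [norm_mul, norm_mul, Complex.norm_cpow_eq_rpow_re_of_pos hl0, Complex.norm_real, Real.norm_eq_abs,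
      abs_of_pos hx0]
    simp
  have hAle : ‖A‖ ≤ C * x * l ^ (z.re - 2) + ‖G‖ * x * l ^ (z.re - 1) := by
    have := norm_le_norm_sub_add A (G * (x : ℝ) * ((l : ℝ) : ℂ) ^ (z - 1))
    rw [hmainnorm] at this
    linarith
  have hS : ‖∑ n ∈ range (x + 1), z ^ (∑ i, ArithmeticFunction.cardFactors (((fX i).eval (n : ℤ)).toNat))‖
      ≤ 1 + C * x * l ^ (z.re - 2) + ‖G‖ * x * l ^ (z.re - 1) := by
    rw [sum_fX_eq, ← hA]
    calc ‖1 + A‖ ≤ ‖(1 : ℂ)‖ + ‖A‖ := norm_add_le _ _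
      _ ≤ 1 + (C * x * l ^ (z.re - 2) + ‖G‖ * x * l ^ (z.re - 1)) := by rw [norm_one]; gcongr
      _ = _ := by ring
  -- assemble
  have hH : ‖H 1 fX x z‖ ≤
      (x : ℝ)⁻¹ * l ^ (1 - z.re) * (1 + C * x * l ^ (z.re - 2) + ‖G‖ * x * l ^ (z.re - 1)) := by
    simp only [H]
    rw [norm_mul, norm_mul, hN, norm_inv, Complex.norm_natCast]
    gcongr
  have hp1 : l ^ (1 - z.re) * l ^ (z.re - 1) = 1 := by rw [← Real.rpow_add hl0]; simp
  have hp2 : l ^ (1 - z.re) * l ^ (z.re - 2) = l⁻¹ := by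
    rw [← Real.rpow_add hl0, show 1 - z.re + (z.re - 2) = (-1 : ℝ) by ring, Real.rpow_neg_one]
  have hexpand : (x : ℝ)⁻¹ * l ^ (1 - z.re) * (1 + C * x * l ^ (z.re - 2) + ‖G‖ * x * l ^ (z.re - 1))
      = (x : ℝ)⁻¹ * l ^ (1 - z.re) + C * (l ^ (1 - z.re) * l ^ (z.re - 2)) * ((x : ℝ)⁻¹ * x)
        + ‖G‖ * (l ^ (1 - z.re) * l ^ (z.re - 1)) * ((x : ℝ)⁻¹ * x) := by ring
  rw [hexpand, hp1, hp2, inv_mul_cancel₀ hx0.ne', mul_one, mul_one, mul_one] at hH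
  have ht1 : (x : ℝ)⁻¹ * l ^ (1 - z.re) ≤ 4 := inv_mul_log_rpow_le hx (by linarith)
  have ht2 : C * l⁻¹ ≤ |C| := by
    have hlinv : l⁻¹ ≤ 1 := inv_le_one_of_one_le₀ hl1
    have hlinv0 : 0 ≤ l⁻¹ := inv_nonneg.mpr hl0.le
    calc C * l⁻¹ ≤ |C| * l⁻¹ := by gcongr; exact le_abs_self C
      _ ≤ |C| * 1 := by gcongr
      _ = |C| := mul_one _
  have ht3 : ‖G‖ ≤ K := hK z hz
  linarith

/-- CALIBRATION AT `f = (X)` (the grounder's "item = fact ∘ specialisation", checked): the printed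
Selberg–Delange law for `Σ_{n≤x} z^{Ω(n)}` (Montgomery–Vaughan Thm 7.18 with (7.60), `|z| ≤ R < 2`, vendored
fact `MontgomeryVaughan2007_thm_7_18_Omega`) implies that the genuine Bateman–Horn system `(X)` belongs to
`locallyBoundedSystems (7/4) 1` — i.e. the `k = 1`, `f = X` instance of the crux, with EXACTLY the crux's
normalisation `x⁻¹ (log x)^{1−z}`, its junk terms (`n = 0`, `x ≤ 2`) and its rectangle (`V_{7/4,1/4} ⊂
{|z| ≤ 9/5}`). A mis-normalised crux would have been refuted by this computation; it is not.
[cite: MontgomeryVaughan2007, §7.4 Theorem 7.18 and (7.60)] -/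
theorem fX_mem_locallyBoundedSystems_of_MV (hMV : MontgomeryVaughan2007_thm_7_18_Omega) :
    fX ∈ locallyBoundedSystems (7 / 4) 1 := by
  obtain ⟨C, hC⟩ := hMV (9 / 5) (by norm_num)
  set K : ℝ := 3 / 2 * Real.log 2 ^ (-(4 / 5) : ℝ) + |C| * (Real.log 2)⁻¹
  have hK : ∀ z : ℂ, ‖z‖ ≤ 9 / 5 → ‖selbergDelangeOmegaF z * (Complex.Gamma z)⁻¹‖ ≤ K :=
    fun z hz => norm_G_le hC hz
  refine ⟨1 / 4, by norm_num, le_rfl, fun a _ => ⟨48 + (4 + |C| + K), 1, one_pos, fun x z hz => ?_⟩⟩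
  have hzV := hz.2
  have hK0 : 0 ≤ K := (norm_nonneg _).trans (hK z (norm_le_of_mem_V hzV))
  rcases le_or_gt x 2 with hx | hx
  · have := norm_H_fX_le_of_le_two hx (norm_le_of_mem_V hzV) (by linarith [hzV.1]) hzV.2.1
    have : 0 ≤ |C| := abs_nonneg C
    linarith
  · have := norm_H_fX_le_of_three_le (x := x) hC hK (by omega) hzV
    linarith

end

end Summit.Parity.BatemanHorn.Theorems.NormalFamilyBound.Negative
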